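import Literature.Analysis.FluidPDE.NormalisedPressure
import HarnessLib

/-!
# Affine covariance of the normalised pressure

Analysis/FluidPDE support file (serves the discharge of the barrier fact
`Literature.Barriers.NavierStokesRegularity.NSISwitching`, Scheffer 1985 / Ożański 2017, where
rescaled copies `τ^{-j} u(Γ^{-j} x, ·)`, `Γ(x) = τx + z`, of a classical solution of the
Navier–Stokes inequality are glued together and the pressure function of each copy must be
identified with the rescaled pressure function).

For the normalised (Riesz-transform) pressure `p̃[u] = -Δ⁻¹∂ᵢ∂ⱼ(uᵢuⱼ)` of the accepted
`NormalisedPressure.lean` (realised pointwise by the principal-value singular integral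
`p̃[u](x) = -|u(x)|²/d + p.v.∫ K(x-y)(u y) dy`) we prove, for EVERY velocity slice `u : E → E`
(no regularity or decay assumed, the junk branch being covariant as well), every dilation
factor `γ > 0` and translation `x₀`:

* `pressureKernel_smul_left` — the kernel is homogeneous of degree `-d`:
  `K(c z)(v) = |c|^{-d} K(z)(v)`;
* `truncatedPressureIntegral_comp_affine` — `∫_{|x-y|>ε} K(x-y)(u(x₀+γy)) dy
  = ∫_{|x'-w|>γε} K(x'-w)(u w) dw`, `x' = x₀ + γx` (change of variables `w = x₀ + γy`);
* `hasPressurePV_comp_affine_iff` — principal values correspond under the substitution;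
* `normalisedPressure_comp_affine` — **`p̃[u(x₀ + γ·)](x) = p̃[u](x₀ + γx)`**, and with the
  2-homogeneity `normalisedPressure_smul` of the accepted file,
  `normalisedPressure_smul_comp_affine` — `p̃[α u(x₀ + γ·)](x) = α² p̃[u](x₀ + γx)`, the
  transformation law of the pressure under the Navier–Stokes scaling
  `u ↦ α u(x₀ + γ ·)` (Ożański 2017, §2, the rescaled fields (2.4); Scheffer 1985, proof of
  Lemma 2.3, p. 56: `p^{j+1}(x,t) = τ⁻² pʲ(τ⁻¹(x-a), …)`).

## Mathlib search

`MeasureTheory.Measure.integral_comp_smul` (`∫ f(R•x) = |R^d|⁻¹ ∫ f`), `integral_add_left_eq_self`,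
`integrable_comp_smul_iff`, `Integrable.comp_add_left`, `integral_indicator`,
`integrable_indicator_iff` (all used); nothing on Riesz transforms / singular integrals.

## References

* W. S. Ożański, *On weak solutions to the Navier–Stokes inequality with internal
  singularities*, arXiv:1709.00602 (2017), §2 (2.4). [`Ozanski2017NSISingular`]
* V. Scheffer, *A solution to the Navier–Stokes inequality with an internal singularity*,
  Comm. Math. Phys. 101 (1985), proof of Lemma 2.3, p. 56. [`Scheffer1985`]
* E. M. Stein, *Singular integrals and differentiability properties of functions* (1970), III §1
  (dilation invariance of the Riesz transforms).
-/

noncomputable section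

open MeasureTheory Set Filter Metric Topology Module

namespace Literature.Analysis.FluidPDE

variable {E : Type*} [NormedAddCommGroup E] [InnerProductSpace ℝ E] [FiniteDimensional ℝ E]
  [MeasurableSpace E] [BorelSpace E]

open scoped RealInnerProductSpace

/-! ### Homogeneity of the kernel -/

/-- The surface area of the unit sphere is positive as soon as `E ≠ 0`. [folklore] -/
theorem unitSphereArea_pos [Nontrivial E] : 0 < unitSphereArea E := by
  rw [unitSphereArea_eq]
  have h1 : (0 : ℝ) < Module.finrank ℝ E := by exact_mod_cast Module.finrank_pos
  have h2 : 0 < (volume : Measure E).real (ball 0 1) :=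
    ENNReal.toReal_pos (measure_ball_pos volume (0 : E) one_pos).ne' measure_ball_lt_top.ne
  exact mul_pos h1 h2

/-- **The pressure kernel is homogeneous of degree `-d`** in the space variable:
`K(c z)(v) = |c|^{-d} K(z)(v)` for `c ≠ 0` (`d = dim E`). [folklore] -/
theorem pressureKernel_smul_left {c : ℝ} (hc : c ≠ 0) (z v : E) :
    pressureKernel (c • z) v = (|c| ^ Module.finrank ℝ E)⁻¹ * pressureKernel z v := by
  rcases eq_or_ne z 0 with rfl | hz
  · simp
  haveI : Nontrivial E := ⟨⟨z, 0, hz⟩⟩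
  have hω : unitSphereArea E ≠ 0 := (unitSphereArea_pos (E := E)).ne'
  have hzn : ‖z‖ ≠ 0 := norm_ne_zero_iff.2 hz
  have hca : |c| ≠ 0 := abs_ne_zero.2 hc
  simp only [pressureKernel, inner_smul_left, norm_smul, Real.norm_eq_abs, RCLike.conj_to_real]
  have hc2 : c ^ 2 = |c| ^ 2 := (sq_abs c).symm
  rw [mul_pow, mul_pow, mul_pow, hc2]
  field_simp
  ring

/-! ### The truncated integrals under an affine substitution -/

section Affine

variable (u : E → E) {γ : ℝ} (x₀ : E)

omit [FiniteDimensional ℝ E] [MeasurableSpace E] [BorelSpace E] in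
/-- The affine map `y ↦ x₀ + γ y` scales distances by `γ > 0`. [folklore] -/
theorem norm_affine_sub_affine (hγ : 0 < γ) (x y : E) :
    ‖x₀ + γ • y - (x₀ + γ • x)‖ = γ * ‖y - x‖ := by
  rw [add_sub_add_left_eq_sub, ← smul_sub, norm_smul, Real.norm_of_nonneg hγ.le]

/-- The truncated integrand of the substituted field is, off the excised ball, `γ^d` times the
truncated integrand of `u` at the image point, composed with the substitution; on the excised
balls both indicators vanish together. [folklore] -/
theorem indicator_pressureKernel_comp_affine (hγ : 0 < γ) (x : E) (ε : ℝ) :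
    (closedBall x ε)ᶜ.indicator (fun y => pressureKernel (x - y) (u (x₀ + γ • y))) =
      fun y => γ ^ Module.finrank ℝ E *
        (closedBall (x₀ + γ • x) (γ * ε))ᶜ.indicator
          (fun w => pressureKernel (x₀ + γ • x - w) (u w)) (x₀ + γ • y) := by
  funext y
  have hmem : y ∈ (closedBall x ε)ᶜ ↔ x₀ + γ • y ∈ (closedBall (x₀ + γ • x) (γ * ε))ᶜ := by
    simp only [mem_compl_iff, mem_closedBall, dist_eq_norm, norm_affine_sub_affine x₀ hγ,
      not_le]
    exact (mul_lt_mul_iff_right₀ hγ).symm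
  by_cases hy : y ∈ (closedBall x ε)ᶜ
  · rw [indicator_of_mem hy, indicator_of_mem (hmem.1 hy)]
    have h1 : x₀ + γ • x - (x₀ + γ • y) = γ • (x - y) := by
      rw [add_sub_add_left_eq_sub, smul_sub]
    rw [h1, pressureKernel_smul_left hγ.ne', abs_of_pos hγ, ← mul_assoc,
      mul_inv_cancel₀ (pow_ne_zero _ hγ.ne'), one_mul]
  · rw [indicator_of_notMem hy, indicator_of_notMem (fun h => hy (hmem.2 h)), mul_zero]

/-- **Truncated integrals under the substitution** `w = x₀ + γ y`:
`∫_{|x-y|>ε} K(x-y)(u(x₀+γy)) dy = ∫_{|x'-w|>γε} K(x'-w)(u w) dw`, `x' = x₀ + γx` — the Jacobian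
`γ^{-d}` exactly compensates the homogeneity of the kernel. [folklore] -/
theorem truncatedPressureIntegral_comp_affine (hγ : 0 < γ) (x : E) (ε : ℝ) :
    truncatedPressureIntegral (fun y => u (x₀ + γ • y)) x ε =
      truncatedPressureIntegral u (x₀ + γ • x) (γ * ε) := by
  simp only [truncatedPressureIntegral]
  rw [← integral_indicator measurableSet_closedBall.compl,
    ← integral_indicator measurableSet_closedBall.compl,
    indicator_pressureKernel_comp_affine u x₀ hγ x ε, integral_const_mul]
  set F : E → ℝ := (closedBall (x₀ + γ • x) (γ * ε))ᶜ.indicator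
    fun w => pressureKernel (x₀ + γ • x - w) (u w) with hF
  have h1 : ∫ y, F (x₀ + γ • y) = |(γ ^ Module.finrank ℝ E)⁻¹| * ∫ w, F w := by
    have := Measure.integral_comp_smul volume (fun w => F (x₀ + w)) γ
    simp only [smul_eq_mul] at this
    rw [this, integral_add_left_eq_self]
  rw [h1, ← mul_assoc, abs_of_pos (inv_pos.2 (pow_pos hγ _)),
    mul_inv_cancel₀ (pow_ne_zero _ hγ.ne'), one_mul]

/-- Integrability of the truncated integrands corresponds under the substitution. [folklore] -/
theorem integrableOn_pressureKernel_comp_affine_iff (hγ : 0 < γ) (x : E) (ε : ℝ) :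
    IntegrableOn (fun y => pressureKernel (x - y) (u (x₀ + γ • y))) (closedBall x ε)ᶜ ↔
      IntegrableOn (fun w => pressureKernel (x₀ + γ • x - w) (u w))
        (closedBall (x₀ + γ • x) (γ * ε))ᶜ := by
  rw [← integrable_indicator_iff measurableSet_closedBall.compl,
    ← integrable_indicator_iff measurableSet_closedBall.compl,
    indicator_pressureKernel_comp_affine u x₀ hγ x ε]
  set F : E → ℝ := (closedBall (x₀ + γ • x) (γ * ε))ᶜ.indicator
    fun w => pressureKernel (x₀ + γ • x - w) (u w) with hF
  have hγd : (γ ^ Module.finrank ℝ E) ≠ 0 := pow_ne_zero _ hγ.ne'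
  have key : Integrable (fun y => F (x₀ + γ • y)) (volume : Measure E) ↔ Integrable F volume := by
    rw [show (fun y => F (x₀ + γ • y)) = fun y => (fun w => F (x₀ + w)) (γ • y) from rfl,
      integrable_comp_smul_iff volume (fun w => F (x₀ + w)) hγ.ne']
    exact ⟨fun h => by simpa using h.comp_add_left (-x₀), fun h => h.comp_add_left x₀⟩
  constructor
  · intro h
    have h' := h.const_mul (γ ^ Module.finrank ℝ E)⁻¹
    simp only [← mul_assoc, inv_mul_cancel₀ hγd, one_mul] at h'
    exact key.1 h'
  · intro h
    exact (key.2 h).const_mul _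

/-- Multiplication by `γ > 0` preserves the filter of right-neighbourhoods of `0`. [folklore] -/
theorem tendsto_const_mul_nhdsGT_zero (hγ : 0 < γ) :
    Tendsto (fun ε : ℝ => γ * ε) (𝓝[>] 0) (𝓝[>] 0) := by
  refine tendsto_nhdsWithin_iff.2 ⟨?_, ?_⟩
  · have : Tendsto (fun ε : ℝ => γ * ε) (𝓝 0) (𝓝 (γ * 0)) :=
      tendsto_id.const_mul γ
    rw [mul_zero] at this
    exact this.mono_left nhdsWithin_le_nhds
  · filter_upwards [self_mem_nhdsWithin] with ε hε using mul_pos hγ hε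

/-- **Principal values correspond under the substitution**: `u(x₀ + γ·)` has principal value
`L` at `x` iff `u` has principal value `L` at `x₀ + γx`. [folklore] -/
theorem hasPressurePV_comp_affine_iff (hγ : 0 < γ) (x : E) (L : ℝ) :
    HasPressurePV (fun y => u (x₀ + γ • y)) x L ↔ HasPressurePV u (x₀ + γ • x) L := by
  have hT : truncatedPressureIntegral (fun y => u (x₀ + γ • y)) x =
      truncatedPressureIntegral u (x₀ + γ • x) ∘ fun ε => γ * ε :=
    funext fun ε => truncatedPressureIntegral_comp_affine u x₀ hγ x ε
  have hsc := tendsto_const_mul_nhdsGT_zero hγ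
  have hsc' := tendsto_const_mul_nhdsGT_zero (inv_pos.2 hγ)
  have hγγ : ∀ ε : ℝ, γ * (γ⁻¹ * ε) = ε := fun ε => by
    rw [← mul_assoc, mul_inv_cancel₀ hγ.ne', one_mul]
  constructor
  · rintro ⟨hI, hL⟩
    refine ⟨?_, ?_⟩
    · have h1 := hsc'.eventually hI
      refine h1.mono fun ε hε => ?_
      have := (integrableOn_pressureKernel_comp_affine_iff u x₀ hγ x (γ⁻¹ * ε)).1 hε
      rwa [hγγ] at this
    · rw [hT] at hL
      have := hL.comp hsc'
      refine this.congr fun ε => ?_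
      simp only [Function.comp_apply, hγγ]
  · rintro ⟨hI, hL⟩
    refine ⟨?_, ?_⟩
    · have h1 := hsc.eventually hI
      exact h1.mono fun ε hε =>
        (integrableOn_pressureKernel_comp_affine_iff u x₀ hγ x ε).2 hε
    · rw [hT]
      exact hL.comp hsc

/-- **Affine covariance of the normalised pressure**: `p̃[u(x₀ + γ·)](x) = p̃[u](x₀ + γx)` for
every field `u : E → E`, every `γ > 0` and `x₀ ∈ E` (both the principal-value branch and the
junk branch of `normalisedPressure` correspond under the substitution `w = x₀ + γy`; Stein 1970,
III §1: the Riesz transforms commute with dilations and translations).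
[cite: Ozanski2017NSISingular, §2 (2.4)] -/
theorem normalisedPressure_comp_affine (hγ : 0 < γ) (x : E) :
    normalisedPressure (fun y => u (x₀ + γ • y)) x = normalisedPressure u (x₀ + γ • x) := by
  by_cases h : ∃ L, HasPressurePV u (x₀ + γ • x) L
  · obtain ⟨L, hL⟩ := h
    rw [normalisedPressure_eq hL,
      normalisedPressure_eq ((hasPressurePV_comp_affine_iff u x₀ hγ x L).2 hL)]
  · have h' : ¬ ∃ L, HasPressurePV (fun y => u (x₀ + γ • y)) x L := fun ⟨L, hL⟩ =>
      h ⟨L, (hasPressurePV_comp_affine_iff u x₀ hγ x L).1 hL⟩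
    rw [normalisedPressure_eq_zero_of_not_exists h, normalisedPressure_eq_zero_of_not_exists h']

/-- Function form of `normalisedPressure_comp_affine`. [cite: Ozanski2017NSISingular, §2 (2.4)] -/
theorem normalisedPressure_comp_affine' (hγ : 0 < γ) :
    normalisedPressure (fun y => u (x₀ + γ • y)) = fun x => normalisedPressure u (x₀ + γ • x) :=
  funext fun x => normalisedPressure_comp_affine u x₀ hγ x

/-- **The pressure under the Navier–Stokes scaling**: for the rescaled slice
`v(y) = α u(x₀ + γy)`, `p̃[v](x) = α² p̃[u](x₀ + γx)` (Ożański 2017, §2: the pressure function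
of `u^{(j)} = τ^{-j}u(Γ^{-j}·)` is `τ^{-2j} p(Γ^{-j}·)`; Scheffer 1985, p. 56).
[cite: Ozanski2017NSISingular, §2 (2.4)] -/
theorem normalisedPressure_smul_comp_affine (α : ℝ) (hγ : 0 < γ) (x : E) :
    normalisedPressure (fun y => α • u (x₀ + γ • y)) x = α ^ 2 * normalisedPressure u (x₀ + γ • x) := by
  have h1 : (fun y => α • u (x₀ + γ • y)) = α • fun y => u (x₀ + γ • y) := rfl
  rw [h1, normalisedPressure_smul, normalisedPressure_comp_affine u x₀ hγ x]

end Affine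

end Literature.Analysis.FluidPDE

end
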